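import Summits.ValiantsHypothesis.ValiantsHypothesis.Theorems.TwistedDetRankSliceVBPFermionicDEvenGadgetCovers

/-!
# Crux `TwistedDetRank.SliceVBPFermionic` (stmt-ValiantsHypothesis-17991, X2b) — the last falsifier
# `D^even` is `VNP ⊄ VBP`-hard: `D^even_{8b}` projects onto `± Ferm²_b`

The falsifier census of X2b (Cruxes/SliceVBPFermionic/CALIBRATION.md §3) had exactly one survivor:
`D^even_n = Σ_{σ : all cycles even} sgn σ X^σ` ("tdr-blind: no lower bound, no algorithm").  The
sequel Theorems/TwistedDetRankSliceVBPFermionicDEvenTdr.lean gives it super-quasi-polynomial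
twisted rank; this file KILLS it as a refutation candidate, exactly like the other census rows:

* §1 counting: `#{s : β → Bool | s ∘ (e σ e⁻¹) = ¬ s} = #{s : α → Bool | s ∘ σ = ¬ s}`, and for the
  block swap `σ_{1,ρ}` of the return gadget the `2`-colourings are the pairs `(u, ¬u)` with `u`
  `ρ`-INVARIANT, whose number is `2^{numCycles ρ}` (functions on the orbit quotient,
  tree `numCycles_eq_numOrbits`).
* §2 transport of the layer-switch identity to `Fin (a·4)` (`aeval_laySubstFin_gmf`) and the
  DOUBLING: `(0 Y; 1 0)` (`aeval_retSubstFin_one_gmf`, ReturnGadget) sends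
  `Σ_ρ (-1)^a sgn ρ N(ρ) Y^ρ` (`a = b + b`) to `ε · Ferm²_b`, `ε = sgn(block swap)`
  (`aeval_retSubstFin_one_layGmf`).
* §3 `dc(Ferm²_b) ≤ dc(D^even_{8b}) + 1` (`hasDetRepr_fermionicPencil_two_of_dEven`), so by
  de Rugy-Altherre's reduction in the tree (`not_dcPerSuperpolynomial_of_fermionicPencil_hasDetRepr`,
  `t = 2`): **`D^even` lies in the VBP slice only if `VBP = VNP`**
  (`not_dcPerSuperpolynomial_of_dEven_hasDetRepr`); contrapositively, under Valiant's hypothesis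
  X2b holds AT `D^even` (`sliceVBPFermionic_at_dEven`).  With this row the census is closed: every
  recorded falsifier of X2b is `VNP ⊄ VBP`-hard in the kernel.

HONEST FRAMING.  Census work on the refutation side: X2b is ≥ `VNP ⊄ VBP`
(Theorems/TwistedDetRankSliceVBPFermionicCalibration.lean) and is neither proved nor refuted;
no refutation path through a recorded candidate remains.  `VP ≠ VNP` is not moved by this item.

References: N. de Rugy-Altherre, CiE 2013, LNCS 7921, 87–96, Thm. 1; S. Mertens, C. Moore,
Theory of Computing 9 (2013) 273–282, Thms 1–2; L. G. Valiant, STOC 1979; P. Bürgisser,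
*Completeness and Reduction in Algebraic Complexity Theory* (2000) §2.1.  The `def`s `layEquiv`,
`laySubstFin` are proof gadgets (the transported substitution), not route objects.
-/

-- single-conjunct layout: Sub = Summit, duplicated namespace component intended
set_option linter.dupNamespace false

noncomputable section

namespace Summit.ValiantsHypothesis.ValiantsHypothesis.Theorems.TwistedDetRankSliceVBPFermionic

open Equiv Equiv.Perm MvPolynomial Literature.Computability.AlgebraicComplexity
open Summit.ValiantsHypothesis.ValiantsHypothesis.Theorems.TwistedDetRankFermionicNormalForm
open scoped BigOperators

/-! ## §1 Counting `2`-colourings and invariant colourings -/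

section Counting

variable {α β : Type*} [Fintype α] [DecidableEq α] [Fintype β] [DecidableEq β]

omit [Fintype α] [DecidableEq α] [Fintype β] [DecidableEq β] in
/-- The number of `2`-colourings `s ∘ σ = ¬ s` is invariant under transport of structure.
[folklore] -/
theorem card_antiInvariant_permCongr (e : α ≃ β) (σ : Perm α)
    [Fintype {s : β → Bool // ∀ y, s (e.permCongr σ y) = !s y}]
    [Fintype {s : α → Bool // ∀ x, s (σ x) = !s x}] :
    Fintype.card {s : β → Bool // ∀ y, s (e.permCongr σ y) = !s y} =
      Fintype.card {s : α → Bool // ∀ x, s (σ x) = !s x} := by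
  refine Fintype.card_congr
    { toFun := fun s => ⟨fun x => s.1 (e x), fun x => ?_⟩
      invFun := fun s => ⟨fun y => s.1 (e.symm y), fun y => ?_⟩
      left_inv := fun s => Subtype.ext (funext fun y => by simp)
      right_inv := fun s => Subtype.ext (funext fun x => by simp) }
  · have h := s.2 (e x)
    rw [Equiv.permCongr_apply, Equiv.symm_apply_apply] at h
    exact h
  · show s.1 (e.symm (e.permCongr σ y)) = !s.1 (e.symm y)
    rw [Equiv.permCongr_apply, Equiv.symm_apply_apply]
    exact s.2 (e.symm y)

omit [Fintype α] [DecidableEq α] in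
/-- An invariant colouring is constant along powers. [folklore] -/
theorem bool_pow_apply_of_invariant {σ : Perm α} {u : α → Bool} (hu : ∀ x, u (σ x) = u x)
    (n : ℕ) (x : α) : u ((σ ^ n) x) = u x := by
  induction n generalizing x with
  | zero => simp
  | succ n ih => rw [pow_succ', Perm.mul_apply, hu, ih]

/-- **Invariant `2`-colourings are functions on the orbit quotient**: their number is
`2^{numCycles σ}` (cycles counted with fixed points; tree `numCycles_eq_numOrbits`). [folklore] -/
theorem card_invariant_eq_two_pow_numCycles (σ : Perm α)
    [Fintype {u : α → Bool // ∀ x, u (σ x) = u x}] :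
    Fintype.card {u : α → Bool // ∀ x, u (σ x) = u x} = 2 ^ σ.numCycles := by
  classical
  rw [DeRugyAltherre.numCycles_eq_numOrbits]
  unfold DeRugyAltherre.numOrbits
  rw [← Fintype.card_bool, ← Fintype.card_fun]
  refine Fintype.card_congr
    { toFun := fun u => Quotient.lift u.1 (fun x y (h : SameCycle σ x y) => ?_)
      invFun := fun f => ⟨fun x => f (DeRugyAltherre.orbitOf σ x), fun x => congrArg f ?_⟩
      left_inv := fun u => Subtype.ext (funext fun x => rfl)
      right_inv := fun f => funext fun q => Quotient.inductionOn q fun x => rfl }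
  · have h' : SameCycle σ x y := h
    obtain ⟨n, rfl⟩ := h'.exists_nat_pow_eq
    exact (bool_pow_apply_of_invariant u.2 n x).symm
  · rw [DeRugyAltherre.orbitOf_eq_orbitOf_iff]
    exact (sameCycle_apply_left).2 SameCycle.rfl

/-- **The `2`-colourings of a doubled permutation.**  For the block swap `σ_{1,ρ}`
(`inl i ↦ inr i`, `inr i ↦ inl (ρ i)`) the `2`-colourings `s ∘ σ_{1,ρ} = ¬ s` are exactly
`s = (u, ¬u)` with `u` `ρ`-invariant. [folklore] -/
theorem card_antiInvariant_swapPerm {b : ℕ} (ρ : Perm (Fin b))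
    [Fintype {s : Fin b ⊕ Fin b → Bool // ∀ z, s (swapPerm 1 ρ z) = !s z}]
    [Fintype {u : Fin b → Bool // ∀ i, u (ρ i) = u i}] :
    Fintype.card {s : Fin b ⊕ Fin b → Bool // ∀ z, s (swapPerm 1 ρ z) = !s z} =
      Fintype.card {u : Fin b → Bool // ∀ i, u (ρ i) = u i} := by
  refine Fintype.card_congr
    { toFun := fun s => ⟨fun i => s.1 (Sum.inl i), fun i => ?_⟩
      invFun := fun u => ⟨Sum.elim u.1 (fun i => !u.1 i), fun z => ?_⟩
      left_inv := fun s => Subtype.ext (funext fun z => ?_)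
      right_inv := fun u => Subtype.ext (funext fun i => rfl) }
  · have h1 := s.2 (Sum.inr i)
    have h2 := s.2 (Sum.inl i)
    rw [swapPerm_inr] at h1
    rw [swapPerm_inl, Perm.one_apply] at h2
    simp only at h1 h2 ⊢
    rw [h1, h2, Bool.not_not]
  · rcases z with i | i
    · rw [swapPerm_inl, Perm.one_apply]; simp
    · rw [swapPerm_inr]; simpa using u.2 i
  · rcases z with i | i
    · rfl
    · have h2 := s.2 (Sum.inl i)
      rw [swapPerm_inl, Perm.one_apply] at h2
      simpa using h2.symm

end Counting

/-! ## §2 Transport to `Fin (a·4)` and the doubling onto `± Ferm²` -/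

section Doubling

variable {a : ℕ}

/-- A GMF transports along an equivalence of index types (relabelling of variables and
conjugation of the coefficient function). [folklore] -/
theorem gmf_eq_rename_of_equiv {α β : Type*} [Fintype α] [DecidableEq α] [Fintype β]
    [DecidableEq β] (e : α ≃ β) (χ : Perm β → ℂ) :
    (∑ σ : Perm β, C (χ σ) * ∏ y, (X (σ y, y) : MvPolynomial (β × β) ℂ)) =
      rename (Prod.map e e)
        (∑ τ : Perm α, C (χ (e.permCongr τ)) * ∏ x, (X (τ x, x) : MvPolynomial (α × α) ℂ)) := by
  simp only [map_sum, map_mul, rename_C, map_prod, rename_X, Prod.map_apply]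
  symm
  refine Fintype.sum_equiv e.permCongr _ _ fun τ => ?_
  congr 1
  refine Fintype.prod_equiv e _ _ fun z => ?_
  simp [Equiv.permCongr_apply]

/-- An enumeration of the gadget's index set `Fin a × (Bool ⊕ Bool)` by `Fin (a·4)` (any will
do).  A proof gadget. [folklore] -/
def layEquiv (a : ℕ) : Fin a × (Bool ⊕ Bool) ≃ Fin (a * 4) :=
  Fintype.equivFinOfCardEq (by simp)

/-- The layer-switch substitution transported to `Fin (a·4)`.  A proof gadget. [folklore] -/
def laySubstFin (a : ℕ) : Fin (a * 4) × Fin (a * 4) → MvPolynomial (Fin a × Fin a) ℂ :=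
  fun rc => laySubst ((layEquiv a).symm rc.1, (layEquiv a).symm rc.2)

/-- Every value of the transported substitution is affine. [folklore] -/
theorem totalDegree_laySubstFin_le (rc : Fin (a * 4) × Fin (a * 4)) :
    (laySubstFin a rc).totalDegree ≤ 1 := totalDegree_laySubst_le _

/-- Every value of the transported substitution is a variable or a constant. [folklore] -/
theorem laySubstFin_isVarOrConst (rc : Fin (a * 4) × Fin (a * 4)) :
    (∃ k, laySubstFin a rc = X k) ∨ ∃ c, laySubstFin a rc = C c := laySubst_isVarOrConst _

/-- **The layer-switch gadget on `Fin (a·4)`**: `D^even_{4a}(laySubstFin) =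
Σ_ρ (-1)^a sgn ρ · #{s : s ∘ ρ = ¬ s} · Y^ρ`. [folklore] -/
theorem aeval_laySubstFin_gmf (a : ℕ) :
    aeval (laySubstFin a) (∑ σ : Perm (Fin (a * 4)), C (dEvenClass σ) *
        ∏ k, (X (σ k, k) : MvPolynomial (Fin (a * 4) × Fin (a * 4)) ℂ)) =
      ∑ ρ : Perm (Fin a), C ((-1) ^ a * ((Perm.sign ρ : ℤ) : ℂ) *
          (Fintype.card {s : Fin a → Bool // ∀ i, s (ρ i) = !s i} : ℂ)) *
        ∏ i, (X (ρ i, i) : MvPolynomial (Fin a × Fin a) ℂ) := by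
  rw [gmf_eq_rename_of_equiv (layEquiv a) dEvenClass, aeval_rename]
  simp_rw [dEvenClass_permCongr]
  have hcomp : (laySubstFin a) ∘ (Prod.map (layEquiv a) (layEquiv a)) = laySubst := by
    funext rc
    obtain ⟨r, c⟩ := rc
    simp [laySubstFin]
  rw [hcomp]
  exact aeval_laySubst_gmf a

/-- `(-1)^(b+b) = 1`. -/
theorem neg_one_pow_add_self (b : ℕ) : ((-1 : ℂ)) ^ (b + b) = 1 := by
  rw [← two_mul, pow_mul]; norm_num

/-- **The doubling.**  Substituting `(0 Y; 1 0)` into `Σ_ρ (-1)^{2b} sgn ρ · N(ρ) · Y^ρ` on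
`Fin (b + b)` gives `ε · Ferm²_b(Y)`: on the block swap `σ_{1,ρ'}` the count `N` is the number
of `ρ'`-invariant colourings `2^{numCycles ρ'}` and the sign is `ε · sgn ρ'`. [folklore] -/
theorem aeval_retSubstFin_one_layGmf (b : ℕ) :
    aeval (retSubstFin (1 : Matrix (Fin b) (Fin b) ℂ))
        (∑ ρ : Perm (Fin (b + b)), C ((-1) ^ (b + b) * ((Perm.sign ρ : ℤ) : ℂ) *
            (Fintype.card {s : Fin (b + b) → Bool // ∀ i, s (ρ i) = !s i} : ℂ)) *
          ∏ i, (X (ρ i, i) : MvPolynomial (Fin (b + b) × Fin (b + b)) ℂ)) =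
      C (((Perm.sign (Equiv.sumComm (Fin b) (Fin b) : Perm (Fin b ⊕ Fin b)) : ℤ) : ℂ)) *
        fermionicPencil (Fin b) ℂ (2 : ℂ) := by
  rw [aeval_retSubstFin_one_gmf, fermionicPencil_eq_gmf, Finset.mul_sum]
  refine Finset.sum_congr rfl fun ρ _ => ?_
  rw [← mul_assoc, ← map_mul]
  congr 2
  rw [neg_one_pow_add_self, one_mul, Perm.sign_permCongr, sign_swapPerm, Perm.sign_one, mul_one,
    card_antiInvariant_permCongr, card_antiInvariant_swapPerm, card_invariant_eq_two_pow_numCycles,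
    Units.val_mul, Int.cast_mul]
  push_cast
  ring

/-! ## §3 Determinantal complexity: `D^even` is `VNP ⊄ VBP`-hard -/

/-- **`dc(Ferm²_b) ≤ dc(D^even_{8b}) + 1`**: the layer-switch gadget followed by the doubling is
an affine substitution taking `D^even_{(b+b)·4}` to `ε · Ferm²_b`, and the unit `ε` costs one row.
[folklore] -/
theorem hasDetRepr_fermionicPencil_two_of_dEven {b m : ℕ}
    (h : HasDetRepr (∑ σ : Perm (Fin ((b + b) * 4)), C (dEvenClass σ) *
        ∏ k, (X (σ k, k) : MvPolynomial (Fin ((b + b) * 4) × Fin ((b + b) * 4)) ℂ)) m) :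
    HasDetRepr (fermionicPencil (Fin b) ℂ (2 : ℂ)) (m + 1) := by
  set ε : ℂ := ((Perm.sign (Equiv.sumComm (Fin b) (Fin b) : Perm (Fin b ⊕ Fin b)) : ℤ) : ℂ) with hε
  have hε0 : ε ≠ 0 := Int.cast_ne_zero.2 (Units.ne_zero _)
  have h1 := hasDetRepr_aeval_linear h (laySubstFin (b + b)) totalDegree_laySubstFin_le
  rw [aeval_laySubstFin_gmf] at h1
  have h2 := hasDetRepr_aeval_linear h1 (retSubstFin (1 : Matrix (Fin b) (Fin b) ℂ))
    (totalDegree_retSubstFin_le _)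
  rw [aeval_retSubstFin_one_layGmf, ← hε] at h2
  have h3 := hasDetRepr_C_mul (HasDetRepr.mono_holds h2 (Nat.le_succ m)) ε⁻¹
  rwa [← mul_assoc, ← map_mul, inv_mul_cancel₀ hε0, map_one, one_mul] at h3

/-- `per_?` is a projection of `D^even` through `Ferm²`, in the tree's vocabulary: `ε · Ferm²_b`
is a Valiant PROJECTION of `D^even_{(b+b)·4}` (both substitutions use variables and constants
only). [folklore] -/
theorem isProjection_fermionicPencil_two_dEven (b : ℕ) :
    IsProjection
      (C (((Perm.sign (Equiv.sumComm (Fin b) (Fin b) : Perm (Fin b ⊕ Fin b)) : ℤ) : ℂ)) *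
        fermionicPencil (Fin b) ℂ (2 : ℂ))
      (aeval (laySubstFin (b + b)) (∑ σ : Perm (Fin ((b + b) * 4)), C (dEvenClass σ) *
        ∏ k, (X (σ k, k) : MvPolynomial (Fin ((b + b) * 4) × Fin ((b + b) * 4)) ℂ))) :=
  ⟨retSubstFin (1 : Matrix (Fin b) (Fin b) ℂ), retSubstFin_isVarOrConst _,
    by rw [aeval_laySubstFin_gmf, aeval_retSubstFin_one_layGmf]⟩

/-- **The last falsifier is `VNP ⊄ VBP`-hard.**  If the family `D^even_n` has affine determinantal
representations of p-bounded size then so does the permanent (`¬ DcPerSuperpolynomial ℂ`):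
`D^even_{8b} ↦ ± Ferm²_b` by the layer-switch gadget and the doubling, and `Ferm²` is per-hard in
`dc` currency by de Rugy-Altherre's reduction (`t = 2`).  So `D^even` can refute X2b only together
with a proof of `VBP = VNP`; the census of CALIBRATION.md §3 has no surviving candidate.
[cite: DeRugyAltherre2013, Thm. 1 (§3)] -/
theorem not_dcPerSuperpolynomial_of_dEven_hasDetRepr
    (hdc : ∃ c : ℕ, ∀ n : ℕ, ∃ m ≤ n ^ c + c,
      HasDetRepr (∑ σ : Perm (Fin n), C (dEvenClass σ) *
        ∏ i, (X (σ i, i) : MvPolynomial (Fin n × Fin n) ℂ)) m) :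
    ¬ DcPerSuperpolynomial ℂ := by
  obtain ⟨c, hc⟩ := hdc
  refine not_dcPerSuperpolynomial_of_fermionicPencil_hasDetRepr 2 (by norm_num) (by norm_num)
    ⟨2 * c + 64 ^ c + c + 2, fun b => ?_⟩
  obtain ⟨m, hm, hrep⟩ := hc ((b + b) * 4)
  refine ⟨m + 1, ?_, by exact_mod_cast hasDetRepr_fermionicPencil_two_of_dEven hrep⟩
  -- `m + 1 ≤ (8b)^c + c + 1 ≤ b^(2c) + 64^c + c + 1 ≤ b^c' + c'`
  have h8 : ((b + b) * 4) ^ c ≤ b ^ (2 * c) + 64 ^ c := by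
    rcases Nat.lt_or_ge b 8 with hb | hb
    · have h56 : (b + b) * 4 ≤ 64 := by omega
      exact (Nat.pow_le_pow_left h56 c).trans (Nat.le_add_left _ _)
    · calc ((b + b) * 4) ^ c = 8 ^ c * b ^ c := by rw [show (b + b) * 4 = 8 * b by ring, mul_pow]
        _ ≤ b ^ c * b ^ c := Nat.mul_le_mul_right _ (Nat.pow_le_pow_left hb c)
        _ = b ^ (2 * c) := by rw [two_mul, pow_add]
        _ ≤ b ^ (2 * c) + 64 ^ c := Nat.le_add_right _ _
  rcases Nat.eq_zero_or_pos b with rfl | hb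
  · have hR1 : ((0 + 0) * 4) ^ c ≤ 1 := by
      rcases Nat.eq_zero_or_pos c with rfl | hc0
      · simp
      · rw [show (0 + 0) * 4 = 0 by rfl, zero_pow hc0.ne']
        exact Nat.zero_le _
    generalize hK : 64 ^ c = K at h8 ⊢
    generalize hR : ((0 + 0) * 4) ^ c = R at hm hR1
    generalize hZ : 0 ^ (2 * c + K + c + 2) = Z
    omega
  · have hpow : b ^ (2 * c) ≤ b ^ (2 * c + 64 ^ c + c + 2) :=
      Nat.pow_le_pow_right hb (by generalize 64 ^ c = K; omega)
    generalize hK : 64 ^ c = K at h8 hpow ⊢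
    generalize hP : b ^ (2 * c) = P at h8 hpow
    generalize hQ : b ^ (2 * c + K + c + 2) = Q at hpow ⊢
    generalize hR : ((b + b) * 4) ^ c = R at hm h8
    omega

/-- Contrapositive, as the crux reads it: under Valiant's determinantal hypothesis `D^even` is not
in the VBP slice, so it cannot witness `¬ SliceVBPFermionic`. [folklore] -/
theorem dEven_not_hasDetRepr_of_dcPerSuperpolynomial (h : DcPerSuperpolynomial ℂ) :
    ¬ ∃ c : ℕ, ∀ n : ℕ, ∃ m ≤ n ^ c + c,
      HasDetRepr (∑ σ : Perm (Fin n), C (dEvenClass σ) *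
        ∏ i, (X (σ i, i) : MvPolynomial (Fin n × Fin n) ℂ)) m :=
  fun hdc => not_dcPerSuperpolynomial_of_dEven_hasDetRepr hdc h

/-- **X2b AT `D^even` follows from Valiant's determinantal hypothesis** (vacuously: the family is
then not in the VBP slice).  Together with `sliceVBPFermionic_at_dEven_iff` (the instance is
EXACTLY "not in the VBP slice", file …DEvenTdr) this places the last falsifier with all the others:
`DcPerSuperpolynomial ℂ ⟹ X2b at D^even`, and a refutation of X2b at `D^even` proves `VBP = VNP`.
[folklore] -/
theorem sliceVBPFermionic_at_dEven (h : DcPerSuperpolynomial ℂ) :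
    (∃ c : ℕ, ∀ n : ℕ, ∃ m ≤ n ^ c + c,
      HasDetRepr (∑ σ : Perm (Fin n), C (dEvenClass σ) *
        ∏ i, (X (σ i, i) : MvPolynomial (Fin n × Fin n) ℂ)) m) →
    ∃ c : ℕ, ∀ n : ℕ, 1 ≤ n → ∃ r ≤ 2 ^ ((Nat.log 2 n + c) ^ c),
      ∃ E : Fin r → Matrix (Fin n) (Fin n) ℂ,
        (∑ σ : Perm (Fin n), C (dEvenClass σ) *
            ∏ i, (X (σ i, i) : MvPolynomial (Fin n × Fin n) ℂ)) =
          ∑ t, (Matrix.of fun i j => C (E t i j) * MvPolynomial.X (i, j)).det :=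
  fun hdc => absurd hdc (dEven_not_hasDetRepr_of_dcPerSuperpolynomial h)

end Doubling

end Summit.ValiantsHypothesis.ValiantsHypothesis.Theorems.TwistedDetRankSliceVBPFermionic

end
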